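import Summits.QuantumFields.BalabanUV.T4Continuum.Support.VariationalColourTaxiLines
import Summits.QuantumFields.BalabanUV.T4Continuum.Support.VariationalColourTower
import Summits.QuantumFields.BalabanUV.T4Continuum.Support.VectorLineComposite

/-!
# T⁴ programme, spine node NE2 (U1a), lane P2 — «V-COL-TAXI-TOWER», part 1: THE OPERATOR TAXI TOWER — the NESTED site frames and the NESTED product line
# transports along a tower of one-step bond operators, the road's composition identities BY `rfl` (the data shapes `hTcomp` ∕ `hRtr` of the vector END), and
# the telescoping of straight products across levels (the unit-lattice bond of a coherent tower is level-independent)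

NE2 formalisation swarm `b2b-balaban-t4-ne2-formalise-*`, leaf prover 04 GEN 4 (`prover-b2b-balaban-t4-ne2-formalise-leaf-04-g4-0`); register row «P2-sup» of
`t4/formal/NE2/LEAVES.md`; journal CLAIMS.log «V-COL-TAXI-TOWER».  The operator twin of this lineage's U(1) `VariationalTaxiTower.nestT` (gen 3, p215258), on top of
«V-COL-TAXI» parts 1–2 (`taxiTv`, `coarseTv`, unitarity), leaf-02-g4's `VariationalColourTower.{compTv, Rtrv, compTv_mem_unitary}` (COMP⁺-colour) and leaf-03-g4's
`VectorLineComposite.compL` (V-COMP-L) — all BY NAME.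

THE DATA.  A tower of ONE-STEP bond operators `R′ k : Tor (fine L (fine (L^k) M)) → Fin d → (E →L[ℂ] E)` (the level-`k+1` bonds presented over the level-`k` torus).
THE OBJECTS ([folklore], OURS; `L^(k+1) = L^k·L` by `rfl` throughout, as in gen 3's `nestT`):
 * `Rlev R′ k` — the level-`k` bond operators on `Tor (fine (L^k) M)`: level `0` = the straight coarsening of `R′ 0`, level `k+1` = `Rtrv (L^k) L M (R′ k)` (the one-step
   bonds read on the composite torus) — the vector END's `hRtr : R (k+1) = Rtrv (R′ k)` holds BY `rfl` (`Rlev_succ`);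
 * `nestTv R′ k` — THE NESTED OPERATOR TAXI (site frames at level `k`): level `0` = identity frames, level `k+1` = `compTv (L^k) L M (nestTv k) (taxiTv L (fine (L^k) M) (R′ k))`
   (`nestTv_succ`, rfl); unitary for unitary data (`nestTv_mem_unitary`);
 * `nestLv R′ k` — THE NESTED PRODUCT LINE TRANSPORTS (the carriers of record `QvL (L^k) M (nestLv k)`): level `0` = trivial lines (`n = 1`), level `k+1` =
   `compL (L^k) L M (nestLv k) (lineT L (fine (L^k) M) (taxiTv … (R′ k)) (R′ k))` — the END's `hTcomp : T (k+1) = compL (T k) (T′ k)` BY `rfl` (`nestLv_succ`) with the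
   one-step carriers `T′ k := lineT (taxiTv (R′ k)) (R′ k)` of «V-COL-TAXI»; contractive for contractive data (`norm_nestLv_le_one`).
 * §2 contraction ∕ unitarity; `coarseTv_eq_Rlev`: along a COHERENT tower (`coarseTv (R′ (k+1)) = Rtrv (R′ k)`, [Balaban1985BackgroundPropagators] (3.10) «Ū» SHAPE) the
   one-step coarse bonds ARE the level bonds at every level; §3 TELESCOPING: `piTv_Rtrv_eq_piTv_coarseTv` (`s·L` composite bonds of `Rtrv S` = `s` coarse bonds `coarseTv S`,
   the tree's `bpt_bpt_tstep`), **`coarseTv_Rlev_succ`** ∕ **`coarseTv_Rlev_eq_zero`**: THE UNIT-LATTICE BOND OF A COHERENT TOWER IS LEVEL-INDEPENDENT — the straight product of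
   the `L^k` level-`k` bonds joining the base points of the unit blocks `y`, `y + e_μ` is ONE operator `Rc(y,μ)` for all `k`: the coarse bond of every level's frame-adapted
   reference `frameT (L^k) M (nestTv k) Rc`.
WHAT IS NOT HERE (stated, not hidden; the successor item, typed in this unit's NOTES ∕ HANDOFF): the ONE estimate the vector END needs of these carriers —
(E_k) `‖nestLv k y j t μ − lineT (L^k) M (taxiTv (L^k) M (Rlev k)) (Rlev k) y j t μ‖ ≤ γ′_k` (the nested product line transports ARE the level-`k` product line transports
with the STRAIGHT level-`k` taxi up to `γ′_k = O(d²·c)`, k-UNIFORM under the scale-invariant plaquette class: induction over `compL` — commute the inner taxi past the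
outer run (part 1's rectangle bookkeeping with run length `L·t₂`), merge the two taxis leg by leg (rectangles `j₁ᵢ × L·j₂ᵢ′`, same-direction legs by `piTv_add`), the
increments `O(d²L^{k+2}a_k)` summing geometrically); with (E_k) every level-`k` binder of the END at Bałaban's taxi data is a ONE-STEP lemma of «V-COL-TAXI» ∕
«V-UB-F» at `(n, M) := (L^k, M)`, `R := Rlev k`, frames = the STRAIGHT taxi `taxiTv (L^k) M (Rlev k)` (whose one-bond defect is k-uniformly tiny — the nested
frames `nestTv` are recorded for COMP⁺ but are NOT the reference of choice), `Rc` = the unit-lattice bond of §3; the END itself.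

HONEST FRAMING (T4-DAG p. 1).  Definitions, `rfl`-identities and ordered-product bookkeeping at MODEL level (bond operators DATA; taxi ∕ straight contours OURS; [Balaban1985BackgroundPropagators] (3.10) ∕
(3.15) ∕ (3.19), [Balaban1985AveragingOperations] (125) SHAPES only, no B0, c5); nothing printed is a hypothesis; data `def`s `Rlev` ∕ `nestTv` ∕ `nestLv` only, no
`def … : Prop`, no `sorry`; axioms standard; [folklore] ordered-product bookkeeping.  NE2 NOT proved on either road; NE3 OPEN; spine PROVED 0∕9 unchanged; rung (B)+1 finite T⁴ — NOT infinite volume, NOT mass gap,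
NOT Clay.  HONEST DEPENDENCY (cell, verbatim): continuum YM on T⁴ ⇐ BetaPertH ∧ nine spine estimates (0/9 proved); BetaPertH ⇐ (D1) ∧ (D4) ∧ CAP+tail; G-an2-4 gates asym,
D1 and NE2/3/4.
-/

noncomputable section

namespace Summit.QuantumFields.BalabanUV.T4Continuum.VariationalColourTaxiTransport

open Literature.MathematicalPhysics.QuantumFieldTheory.Balaban1983to89.B5Prop11Plancherel (Tor fine unitVec)
open Literature.MathematicalPhysics.QuantumFieldTheory.Balaban1983to89
open Literature.MathematicalPhysics.QuantumFieldTheory.Balaban1983to89.B5Block118 (tstep bpt)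
open Literature.MathematicalPhysics.QuantumFieldTheory.Balaban1983to89.B5Composition116 (sites bpt_bpt_tstep)
open Summit.QuantumFields.BalabanUV.T4Continuum.VariationalColourFederbush (piTv)
open Summit.QuantumFields.BalabanUV.T4Continuum.VariationalColourFederbush (norm_piTv_le_one norm_le_one_of_mem_unitary)
open Summit.QuantumFields.BalabanUV.T4Continuum.VariationalColourTower (compTv Rtrv norm_compTv_le_one compTv_mem_unitary)
open Summit.QuantumFields.BalabanUV.T4Continuum.VariationalVectorFederbush (lineT norm_lineT_le_one)
open Summit.QuantumFields.BalabanUV.T4Continuum.VectorBlockTrialForm (compL norm_compL_le)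

variable {d : ℕ} {E : Type*} [NormedAddCommGroup E] [NormedSpace ℂ E]
variable (L : ℕ) [NeZero L] (M : Fin d → ℕ) [hM : ∀ μ, NeZero (M μ)]

/-! ## §1 The level-`k` bond operators, the nested site frames and the nested line transports -/

/-- **THE LEVEL-`k` BOND OPERATORS** of the tower: level `0` = the straight coarsening of the first one-step data, level `k+1` = the one-step bonds `R′ k` read on the
composite torus `Tor (fine (L^k·L) M)` (leaf-02-g4's `Rtrv`). [folklore] -/
def Rlev (R' : (k : ℕ) → Tor (fine L (fine (L ^ k) M)) → Fin d → (E →L[ℂ] E)) : (k : ℕ) → Tor (fine (L ^ k) M) → Fin d → (E →L[ℂ] E)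
  | 0 => coarseTv L (fine (L ^ 0) M) (R' 0)
  | k + 1 => Rtrv (L ^ k) L M (R' k)

/-- **THE NESTED OPERATOR TAXI** (site frames at level `k`, fibre at the level-`k` site ↦ fibre at its unit-lattice base point): identity frames at level `0`, then
`nestTv (k+1) = compTv (nestTv k) (taxiTv (R′ k))` — the level-`k` frame of the enclosing site after the one-step taxi. [folklore] -/
def nestTv (R' : (k : ℕ) → Tor (fine L (fine (L ^ k) M)) → Fin d → (E →L[ℂ] E)) : (k : ℕ) → Tor (fine (L ^ k) M) → (E →L[ℂ] E)
  | 0 => fun _ => 1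
  | k + 1 => compTv (L ^ k) L M (nestTv R' k) (taxiTv L (fine (L ^ k) M) (R' k))

/-- **THE NESTED PRODUCT LINE TRANSPORTS** (the carriers of record at level `k`): trivial lines at level `0` (`n = 1`), then
`nestLv (k+1) = compL (nestLv k) (lineT (taxiTv (R′ k)) (R′ k))` (leaf-03-g4's V-COMP-L `compL`). [folklore] -/
def nestLv (R' : (k : ℕ) → Tor (fine L (fine (L ^ k) M)) → Fin d → (E →L[ℂ] E)) :
    (k : ℕ) → Tor M → (Fin d → Fin (L ^ k)) → Fin (L ^ k) → Fin d → (E →L[ℂ] E)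
  | 0 => fun _ _ _ _ => 1
  | k + 1 => compL (L ^ k) L M (nestLv R' k) (lineT L (fine (L ^ k) M) (taxiTv L (fine (L ^ k) M) (R' k)) (R' k))

variable (R' : (k : ℕ) → Tor (fine L (fine (L ^ k) M)) → Fin d → (E →L[ℂ] E))

omit hM in
/-- the END's `hRtr` BY `rfl`: `Rlev (k+1) = Rtrv (L^k) L M (R′ k)`. [folklore] -/
theorem Rlev_succ (k : ℕ) : Rlev L M R' (k + 1) = Rtrv (L ^ k) L M (R' k) := rfl

/-- `nestTv 0 = 1`. [folklore] -/
theorem nestTv_zero (x : Tor (fine (L ^ 0) M)) : nestTv L M R' 0 x = 1 := rfl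

/-- COMP⁺ for frames BY `rfl`: `nestTv (k+1) = compTv (nestTv k) (taxiTv (R′ k))`. [folklore] -/
theorem nestTv_succ (k : ℕ) : nestTv L M R' (k + 1) = compTv (L ^ k) L M (nestTv L M R' k) (taxiTv L (fine (L ^ k) M) (R' k)) := rfl

/-- the END's `hTcomp` BY `rfl`: `nestLv (k+1) = compL (nestLv k) (lineT (taxiTv (R′ k)) (R′ k))`. [folklore] -/
theorem nestLv_succ (k : ℕ) :
    nestLv L M R' (k + 1) = compL (L ^ k) L M (nestLv L M R' k) (lineT L (fine (L ^ k) M) (taxiTv L (fine (L ^ k) M) (R' k)) (R' k)) := rfl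

omit hM in
/-- **COHERENCE READ-OUT**: along a COHERENT tower (`coarseTv L (fine (L^(k+1)) M) (R′ (k+1)) = Rtrv (L^k) L M (R′ k)` — each level's straight `L`-bond coarsening
IS the previous level's bonds, [Balaban1985BackgroundPropagators] (3.10) «Ū» SHAPE) the one-step coarse bonds at every level are the level bonds:
`coarseTv L (fine (L^k) M) (R′ k) = Rlev k` (level `0` by definition). [folklore] -/
theorem coarseTv_eq_Rlev (hcoh : ∀ k, coarseTv L (fine (L ^ (k + 1)) M) (R' (k + 1)) = Rtrv (L ^ k) L M (R' k)) :
    ∀ k, coarseTv L (fine (L ^ k) M) (R' k) = Rlev L M R' k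
  | 0 => rfl
  | k + 1 => hcoh k

/-! ## §2 Contraction and unitarity along the tower -/

variable {R'}

omit hM in
/-- contractive one-step data give contractive level-`k` bonds. [folklore] -/
theorem norm_Rlev_le_one (hR' : ∀ k x μ, ‖R' k x μ‖ ≤ 1) : ∀ (k : ℕ) (x : Tor (fine (L ^ k) M)) (μ : Fin d), ‖Rlev L M R' k x μ‖ ≤ 1
  | 0, x, μ => norm_coarseTv_le_one L (fine (L ^ 0) M) (hR' 0) x μ
  | k + 1, x, μ => by unfold Rlev Rtrv; exact hR' k _ μ

/-- contractive one-step data give contractive nested frames. [folklore] -/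
theorem norm_nestTv_le_one (hR' : ∀ k x μ, ‖R' k x μ‖ ≤ 1) : ∀ (k : ℕ) (x : Tor (fine (L ^ k) M)), ‖nestTv L M R' k x‖ ≤ 1
  | 0, _ => ContinuousLinearMap.norm_id_le
  | k + 1, x => norm_compTv_le_one (L ^ k) L M (norm_nestTv_le_one hR' k) (norm_taxiTv_le_one L (fine (L ^ k) M) (hR' k)) x

/-- contractive one-step data give contractive nested line transports. [folklore] -/
theorem norm_nestLv_le_one (hR' : ∀ k x μ, ‖R' k x μ‖ ≤ 1) :
    ∀ (k : ℕ) (y : Tor M) (j : Fin d → Fin (L ^ k)) (t : Fin (L ^ k)) (μ : Fin d), ‖nestLv L M R' k y j t μ‖ ≤ 1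
  | 0, _, _, _, _ => ContinuousLinearMap.norm_id_le
  | k + 1, y, j, t, μ => norm_compL_le (L ^ k) L M (norm_nestLv_le_one hR' k)
      (norm_lineT_le_one L (fine (L ^ k) M) (hR' k) (norm_taxiTv_le_one L (fine (L ^ k) M) (hR' k))) y j t μ

section Unitary

variable {H : Type*} [NormedAddCommGroup H] [InnerProductSpace ℂ H] [CompleteSpace H]
variable {U' : (k : ℕ) → Tor (fine L (fine (L ^ k) M)) → Fin d → (H →L[ℂ] H)} (hU : ∀ k x μ, U' k x μ ∈ unitary (H →L[ℂ] H))
include hU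

omit hM in
/-- unitary one-step data give unitary level-`k` bonds. [folklore] -/
theorem Rlev_mem_unitary : ∀ (k : ℕ) (x : Tor (fine (L ^ k) M)) (μ : Fin d), Rlev L M U' k x μ ∈ unitary (H →L[ℂ] H)
  | 0, x, μ => coarseTv_mem_unitary L (fine (L ^ 0) M) (hU 0) x μ
  | k + 1, x, μ => by unfold Rlev Rtrv; exact hU k _ μ

/-- **unitary one-step data give unitary nested frames** (the END's frames have adjoint right inverses). [folklore] -/
theorem nestTv_mem_unitary : ∀ (k : ℕ) (x : Tor (fine (L ^ k) M)), nestTv L M U' k x ∈ unitary (H →L[ℂ] H)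
  | 0, _ => Submonoid.one_mem _
  | k + 1, x => compTv_mem_unitary (L ^ k) L M (nestTv_mem_unitary k) (taxiTv_mem_unitary L (fine (L ^ k) M) (hU k)) x

end Unitary

/-! ## §3 Straight products telescope across levels: the unit-lattice bond of the tower -/

section Telescope

variable (n : ℕ) [NeZero n]

omit hM in
/-- all digits zero: `J n L 0 0 = 0`. [folklore] -/
theorem J_zero : B5Composition116.J n L (0 : Fin d → Fin n) (0 : Fin d → Fin L) = 0 := by
  funext ν; exact Fin.ext (by simp [B5Composition116.J, finProdFinEquiv])

omit [NeZero L] hM [NeZero n] in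
/-- a straight transporter of the one-step bonds READ ON THE COMPOSITE TORUS is the straight transporter of the one-step bonds, once the base points correspond
under `sites` along the whole line. [folklore] -/
theorem piTv_Rtrv_of_sites (S : Tor (fine L (fine n M)) → Fin d → (E →L[ℂ] E)) (μ : Fin d) {X : Tor (fine (n * L) M)} {X' : Tor (fine L (fine n M))}
    (h : ∀ u : ℕ, sites n L M (X + tstep (fine (n * L) M) μ u) = X' + tstep (fine L (fine n M)) μ u) :
    ∀ t : ℕ, piTv (n * L) M (Rtrv n L M S) X μ t = piTv L (fine n M) S X' μ t
  | 0 => rfl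
  | t + 1 => by simp only [piTv, piTv_Rtrv_of_sites S μ h t, Rtrv, h t]

/-- **TELESCOPING**: `s·L` composite-torus bonds of `Rtrv S` from the base point of the unit block `y` = the straight product of `s` COARSE bonds `coarseTv S`
(groups of `L`; the tree's (1.16)–(1.18) reindexing `bpt_bpt_tstep`). [folklore] -/
theorem piTv_Rtrv_eq_piTv_coarseTv (S : Tor (fine L (fine n M)) → Fin d → (E →L[ℂ] E)) (y : Tor M) (μ : Fin d) :
    ∀ s : ℕ, piTv (n * L) M (Rtrv n L M S) (bpt (n * L) M y 0) μ (s * L) = piTv n M (coarseTv L (fine n M) S) (bpt n M y 0) μ s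
  | 0 => by simp [piTv]
  | s + 1 => by
    rw [Nat.succ_mul, piTv_add, piTv_Rtrv_eq_piTv_coarseTv S y μ s]
    simp only [piTv, coarseTv]
    congr 1
    refine piTv_Rtrv_of_sites L M n S μ (fun u => ?_) L
    rw [add_assoc, ← VectorBlockTrialForm.tstep_add, bpt_bpt_tstep n L M y 0 0 μ s u, J_zero, show u + L * s = s * L + u by ring]

/-- **THE UNIT-LATTICE BOND OF A COHERENT TOWER IS LEVEL-INDEPENDENT**: the straight product of the `L^(k+1)` level-`k+1` bonds joining the base points of the unit
blocks `y` and `y + e_μ` equals the product of the `L^k` level-`k` bonds — so `coarseTv (L^k) M (Rlev k) y μ` is ONE operator `Rc(y,μ)` for all `k`, the coarse bond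
of every level's frame-adapted reference. [folklore] -/
theorem coarseTv_Rlev_succ (hcoh : ∀ k, coarseTv L (fine (L ^ (k + 1)) M) (R' (k + 1)) = Rtrv (L ^ k) L M (R' k)) (k : ℕ) (y : Tor M) (μ : Fin d) :
    coarseTv (L ^ (k + 1)) M (Rlev L M R' (k + 1)) y μ = coarseTv (L ^ k) M (Rlev L M R' k) y μ := by
  show piTv (L ^ k * L) M (Rtrv (L ^ k) L M (R' k)) (bpt (L ^ k * L) M y 0) μ (L ^ k * L) = piTv (L ^ k) M (Rlev L M R' k) (bpt (L ^ k) M y 0) μ (L ^ k)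
  rw [piTv_Rtrv_eq_piTv_coarseTv L M (L ^ k) (R' k) y μ (L ^ k), coarseTv_eq_Rlev L M R' hcoh k]

/-- hence every level's unit-lattice bond is level `0`'s. [folklore] -/
theorem coarseTv_Rlev_eq_zero (hcoh : ∀ k, coarseTv L (fine (L ^ (k + 1)) M) (R' (k + 1)) = Rtrv (L ^ k) L M (R' k)) :
    ∀ (k : ℕ) (y : Tor M) (μ : Fin d), coarseTv (L ^ k) M (Rlev L M R' k) y μ = coarseTv (L ^ 0) M (Rlev L M R' 0) y μ
  | 0, _, _ => rfl
  | k + 1, y, μ => by rw [coarseTv_Rlev_succ L M hcoh k y μ, coarseTv_Rlev_eq_zero hcoh k y μ]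

end Telescope

end Summit.QuantumFields.BalabanUV.T4Continuum.VariationalColourTaxiTransport

end
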